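import Mathlib
import Literature.NumberTheory.Transcendental.KZCalculus
import Literature.NumberTheory.Transcendental.KZLogCalculusProofs
import Literature.NumberTheory.Transcendental.KZSemialgebraicComplex
import Literature.NumberTheory.Transcendental.EllIterRepShuffle
import Literature.NumberTheory.Transcendental.EllIterRep
import Literature.NumberTheory.Transcendental.SemialgebraicMapsProofs
import Summits.KontsevichZagierPeriods.KontsevichZagierPeriods.Theorems.TorsionLogsNeronTorsionSectorStubHaarReps
import Summits.KontsevichZagierPeriods.KontsevichZagierPeriods.Theorems.TorsionLogsNeronTorsionSectorAssemblyReps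
import Summits.KontsevichZagierPeriods.KontsevichZagierPeriods.Theorems.HurwitzMicroSectorsNormalFormPrincipleDilogExistsSimplexPiecesTwo
import HarnessLib

/-!
# Crux `TorsionLogs.NeronTorsionSector` (stmt-KontsevichZagierPeriods-14500) — assembly, objects in the corner chart

Helper for the lead's stub `stub_assembly` (line `registered`): `ℚ`-semialgebraicity of the cell / half-cell shapes
of the translation chain, the rule-(1a) splitting of a square cell into its two triangles, and the construction of
the representations living in the compactifying chart `s = x^{-1/2}` at infinity: the corner cell
`[(0,s₁)², ĥ(s′)(2/R s)(2/R s′)]`, the mixed cell `[(al,ar)×(0,s₁), ĥ(s′)(√f x)⁻¹(2/R s′)]` and the line reps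
`[(0,s₁), g·(2/R)]`, from continuity / boundedness data (`asmReps_exists_rep2`, `asmReps_exists_rep1`).
[cite: KontsevichZagier2001, §1.1–1.2]
-/

noncomputable section

open Set MeasureTheory Filter Topology
open Literature.NumberTheory.Transcendental Literature.NumberTheory.Transcendental.KZ
open Literature.ModelTheory.ExponentialFields

-- `Summit.KontsevichZagierPeriods.KontsevichZagierPeriods.…` is the tree's mandated layout (single-conjunct summit).
set_option linter.dupNamespace false

namespace Summit.KontsevichZagierPeriods.KontsevichZagierPeriods.Cruxes.NeronTorsionSector.Translation

/-! ### Semialgebraic shapes in the plane -/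

/-- `{z 0 < z 1}` is `ℚ`-semialgebraic. [folklore] -/
theorem asmObj_isSemialgebraic_lt01 : IsSemialgebraic ℚ {z : Fin 2 → ℝ | z 0 < z 1} := by
  simpa using Literature.ModelTheory.ExponentialFields.isSemialgebraic_setOf_eval_lt (k := ℚ) (R := ℝ)
    (MvPolynomial.X (0 : Fin 2)) (MvPolynomial.X 1)

/-- The upper half-cell `{a < z 0 < z 1 < b}` with algebraic `a, b` is `ℚ`-semialgebraic. [folklore] -/
theorem asmObj_isSemialgebraic_triT {a b : ℝ} (ha : IsAlgebraic ℚ a) (hb : IsAlgebraic ℚ b) :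
    IsSemialgebraic ℚ {z : Fin 2 → ℝ | a < z 0 ∧ z 0 < z 1 ∧ z 1 < b} := by
  have h := ((isSemialgebraic_setOf_const_lt_apply (n := 2) ha 0).inter asmObj_isSemialgebraic_lt01).inter
    (isSemialgebraic_setOf_apply_lt_const (n := 2) hb 1)
  convert h using 1; ext z; simp [and_assoc]

/-- The rectangle `{(a < z 0 < b) ∧ c < z 1 < d}` with algebraic corners is `ℚ`-semialgebraic. [folklore] -/
theorem asmObj_isSemialgebraic_rect {a b c d : ℝ} (ha : IsAlgebraic ℚ a) (hb : IsAlgebraic ℚ b)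
    (hc : IsAlgebraic ℚ c) (hd : IsAlgebraic ℚ d) :
    IsSemialgebraic ℚ {z : Fin 2 → ℝ | (a < z 0 ∧ z 0 < b) ∧ c < z 1 ∧ z 1 < d} :=
  ((isSemialgebraic_setOf_const_lt_apply (n := 2) ha 0).inter
    (isSemialgebraic_setOf_apply_lt_const (n := 2) hb 0)).inter
    ((isSemialgebraic_setOf_const_lt_apply (n := 2) hc 1).inter (isSemialgebraic_setOf_apply_lt_const (n := 2) hd 1))

/-- The half-strip `{(a < z 0 < b) ∧ c < z 1}` with algebraic `a, b, c` is `ℚ`-semialgebraic. [folklore] -/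
theorem asmObj_isSemialgebraic_rectIoi {a b c : ℝ} (ha : IsAlgebraic ℚ a) (hb : IsAlgebraic ℚ b)
    (hc : IsAlgebraic ℚ c) :
    IsSemialgebraic ℚ {z : Fin 2 → ℝ | (a < z 0 ∧ z 0 < b) ∧ c < z 1} :=
  ((isSemialgebraic_setOf_const_lt_apply (n := 2) ha 0).inter
    (isSemialgebraic_setOf_apply_lt_const (n := 2) hb 0)).inter (isSemialgebraic_setOf_const_lt_apply (n := 2) hc 1)

/-- The quadrant `{c < z 0 ∧ c < z 1}` with algebraic `c` is `ℚ`-semialgebraic. [folklore] -/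
theorem asmObj_isSemialgebraic_quadrant {c : ℝ} (hc : IsAlgebraic ℚ c) :
    IsSemialgebraic ℚ {z : Fin 2 → ℝ | c < z 0 ∧ c < z 1} :=
  (isSemialgebraic_setOf_const_lt_apply (n := 2) hc 0).inter (isSemialgebraic_setOf_const_lt_apply (n := 2) hc 1)

/-! ### Splitting a square cell into its triangles -/

/-- **A square cell is the sum of its two triangles** (rule (1a); the diagonal is null):
`[□] − [lower triangle] − [upper triangle] ∈ KZ.relations`. [cite: KontsevichZagier2001, §1.2 rule (1)] -/
theorem asmObj_square_split {a b : ℝ} (ha : IsAlgebraic ℚ a) (hb : IsAlgebraic ℚ b) (r : IntegralRep 2)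
    (hd : r.domain = {z | (a < z 0 ∧ z 0 < b) ∧ a < z 1 ∧ z 1 < b}) :
    ∃ rl ru : IntegralRep 2, rl.domain = {z | a < z 1 ∧ z 1 < z 0 ∧ z 0 < b} ∧ rl.integrand = r.integrand ∧
      ru.domain = {z | a < z 0 ∧ z 0 < z 1 ∧ z 1 < b} ∧ ru.integrand = r.integrand ∧
      of r - of rl - of ru ∈ relations := by
  classical
  have hls : {z : Fin 2 → ℝ | a < z 1 ∧ z 1 < z 0 ∧ z 0 < b} ⊆ r.domain := by
    intro z ⟨h1, h2, h3⟩; rw [hd]; exact ⟨⟨h1.trans h2, h3⟩, h1, h2.trans h3⟩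
  have hus : {z : Fin 2 → ℝ | a < z 0 ∧ z 0 < z 1 ∧ z 1 < b} ⊆ r.domain := by
    intro z ⟨h1, h2, h3⟩; rw [hd]; exact ⟨⟨h1, h2.trans h3⟩, h1.trans h2, h3⟩
  set rl := r.restrict _ (HurwitzMicroSectors.NormalFormPrinciple.PiBox.Dilog.spB_isSemialgebraic_triangle ha hb) hls with hrl
  set ru := r.restrict _ (asmObj_isSemialgebraic_triT ha hb) hus with hru
  refine ⟨rl, ru, rfl, rfl, rfl, rfl, ?_⟩
  let P : Bool → IntegralRep 2 := fun i => if i then rl else ru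
  have hsum : of r - of rl - of ru = of r - ∑ i ∈ (Finset.univ : Finset Bool), of (P i) := by
    simp [P]; abel
  rw [hsum]
  refine of_sub_sum_of_mem_relations_of_subset Finset.univ r P ?_ ?_ ?_ ?_
  · intro i _; cases i <;> simp [P, hrl, hru, hls, hus]
  · intro i _; cases i <;> simp [P, hrl, hru, EqOn]
  · refine measure_mono_null ?_ (volume_setOf_apply_eq_apply (n := 2) (i := 0) (j := 1) (by decide))
    intro z ⟨hz, hzout⟩
    rw [hd] at hz
    simp only [mem_iUnion, Finset.mem_univ, exists_prop, true_and, not_exists] at hzout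
    rcases lt_trichotomy (z 1) (z 0) with h | h | h
    · exact absurd (show z ∈ (P true).domain by simp [P, hrl]; exact ⟨hz.2.1, h, hz.1.2⟩) (hzout true)
    · exact h.symm
    · exact absurd (show z ∈ (P false).domain by simp [P, hru]; exact ⟨hz.1.1, h, hz.2.2⟩) (hzout false)
  · intro i _ j _ hij
    cases i <;> cases j <;> simp at hij ⊢ <;> simp only [P, hrl, hru, Bool.false_eq_true, if_false, if_true,
      IntegralRep.domain_restrict, Set.disjoint_left] <;> intro z hz hz' <;>
      exact lt_irrefl _ (hz.2.1.trans hz'.2.1)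

/-! ### Representations in the chart at infinity -/

/-- Semialgebraicity of `z ↦ φ (z 1)` on `S ⊆ ℝ × B` from that of `φ` on `B`. [cite: BochnakCosteRoy1998, §2.2] -/
theorem asmObj_semialg_apply_one {φ : ℝ → ℝ} {B : Set ℝ} {S : Set (Fin 2 → ℝ)}
    (hφ : IsSemialgebraicFunOn ℚ {t : Fin 1 → ℝ | t 0 ∈ B} (fun t => φ (t 0)))
    (hS : IsSemialgebraic ℚ S) (hSB : S ⊆ {z | z 1 ∈ B}) :
    IsSemialgebraicFunOn ℚ S (fun z : Fin 2 → ℝ => φ (z 1)) := by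
  have hZ1 : IsSemialgebraicFunOn ℚ S (fun z => z 1) :=
    (isSemialgebraicFunOn_aeval hS (MvPolynomial.X 1)).congr fun z _ => by simp
  have hproj : IsSemialgebraicMapOn ℚ S (fun z (_ : Fin 1) => z 1) := IsSemialgebraicMapOn.of_forall hS fun _ => hZ1
  exact IsSemialgebraicFunOn.comp_isSemialgebraicMapOn_holds (g := fun t : Fin 1 → ℝ => φ (t 0)) hφ hproj
    fun z hz => hSB hz

/-- Semialgebraicity of `z ↦ φ (z 0)` on `S ⊆ A × ℝ` from that of `φ` on `A`. [cite: BochnakCosteRoy1998, §2.2] -/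
theorem asmObj_semialg_apply_zero {φ : ℝ → ℝ} {A : Set ℝ} {S : Set (Fin 2 → ℝ)}
    (hφ : IsSemialgebraicFunOn ℚ {t : Fin 1 → ℝ | t 0 ∈ A} (fun t => φ (t 0)))
    (hS : IsSemialgebraic ℚ S) (hSA : S ⊆ {z | z 0 ∈ A}) :
    IsSemialgebraicFunOn ℚ S (fun z : Fin 2 → ℝ => φ (z 0)) := by
  have hZ0 : IsSemialgebraicFunOn ℚ S (fun z => z 0) :=
    (isSemialgebraicFunOn_aeval hS (MvPolynomial.X 0)).congr fun z _ => by simp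
  have hproj : IsSemialgebraicMapOn ℚ S (fun z (_ : Fin 1) => z 0) := IsSemialgebraicMapOn.of_forall hS fun _ => hZ0
  exact IsSemialgebraicFunOn.comp_isSemialgebraicMapOn_holds (g := fun t : Fin 1 → ℝ => φ (t 0)) hφ hproj
    fun z hz => hSA hz

/-- **The representations of the translation chain in the chart at infinity.** Given the chart Haar denominator
`R` (continuous, positive, `ℚ`-semialgebraic on `[0, s₁]`, `s₁` algebraic) and the cubic data: the corner cell
`B00 = [(0,s₁)², ĥ(s′)(2/R s)(2/R s′)]` (`ĥ(s) = (g₂s² + 2g₃s⁴)/4`) and, over an x-chart interval `(al, ar)` right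
of `e₁` on which `1/√f` is integrable, the mixed cell `Cmix = [(al,ar)×(0,s₁), ĥ(s′)(√f x)⁻¹(2/R s′)]` exist as KZ
representations (`asmReps_exists_rep2`). [cite: KontsevichZagier2001, §1.1] -/
theorem asmObj_exists_chart_reps2 :
    ∀ (g₂ g₃ e₁ al ar s₁ : ℝ) (f R : ℝ → ℝ),
    (∀ t, f t = 4 * t ^ 3 - g₂ * t - g₃) → IsAlgebraic ℚ g₂ → IsAlgebraic ℚ g₃ →
    IsAlgebraic ℚ al → IsAlgebraic ℚ ar → IsAlgebraic ℚ s₁ → 0 < s₁ →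
    e₁ ≤ al → (∀ t, e₁ < t → 0 < f t) →
    MeasureTheory.IntegrableOn (fun t => (Real.sqrt (f t))⁻¹) (Set.Ioo al ar) →
    ContinuousOn R (Set.Icc 0 s₁) → (∀ s ∈ Set.Icc 0 s₁, 0 < R s) →
    IsSemialgebraicFunOn ℚ {t : Fin 1 → ℝ | t 0 ∈ Set.Icc 0 s₁} (fun t => R (t 0)) →
    ∃ (B00 Cmix : Literature.NumberTheory.Transcendental.KZ.IntegralRep 2),
      B00.domain = {z | (0 < z 0 ∧ z 0 < s₁) ∧ 0 < z 1 ∧ z 1 < s₁} ∧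
      B00.integrand = (fun z => (g₂ * (z 1) ^ 2 + 2 * g₃ * (z 1) ^ 4) / 4 * (2 / R (z 0)) * (2 / R (z 1))) ∧
      Cmix.domain = {z | (al < z 0 ∧ z 0 < ar) ∧ 0 < z 1 ∧ z 1 < s₁} ∧
      Cmix.integrand = (fun z => (g₂ * (z 1) ^ 2 + 2 * g₃ * (z 1) ^ 4) / 4 * (Real.sqrt (f (z 0)))⁻¹ * (2 / R (z 1))) := by
  intro g₂ g₃ e₁ al ar s₁ f R hf ag₂ ag₃ aal aar as₁ hs₁ hal hfpos hint hRc hRpos hsR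
  -- bounds: `ĥ` on `[0,s₁]`, `2/R` on `[0,s₁]`
  have h0a : IsAlgebraic ℚ (0:ℝ) := isAlgebraic_zero
  obtain ⟨smin, hsmin, hmin⟩ := isCompact_Icc.exists_isMinOn (nonempty_Icc.2 hs₁.le) hRc
  set Rmin := R smin with hRmin
  have hRmin_pos : 0 < Rmin := hRpos smin hsmin
  have hRge : ∀ s ∈ Set.Icc (0:ℝ) s₁, Rmin ≤ R s := fun s hs => hmin hs
  have h2R : ∀ s ∈ Set.Icc (0:ℝ) s₁, |2 / R s| ≤ 2 / Rmin := by
    intro s hs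
    rw [abs_of_pos (div_pos two_pos (hRpos s hs))]
    exact div_le_div_of_nonneg_left zero_le_two hRmin_pos (hRge s hs)
  set Mh : ℝ := (|g₂| * s₁ ^ 2 + 2 * |g₃| * s₁ ^ 4) / 4 with hMh
  have hhat : ∀ s ∈ Set.Icc (0:ℝ) s₁, |(g₂ * s ^ 2 + 2 * g₃ * s ^ 4) / 4| ≤ Mh := by
    intro s hs
    rw [abs_div, abs_of_pos (by norm_num : (0:ℝ) < 4), hMh]
    refine div_le_div_of_nonneg_right ?_ (by norm_num)
    have hs2 : s ^ 2 ≤ s₁ ^ 2 := pow_le_pow_left₀ hs.1 hs.2 2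
    have hs4 : s ^ 4 ≤ s₁ ^ 4 := pow_le_pow_left₀ hs.1 hs.2 4
    calc |g₂ * s ^ 2 + 2 * g₃ * s ^ 4| ≤ |g₂ * s ^ 2| + |2 * g₃ * s ^ 4| := abs_add_le _ _
      _ = |g₂| * s ^ 2 + 2 * |g₃| * s ^ 4 := by
          rw [abs_mul, abs_mul, abs_mul, abs_of_nonneg (pow_nonneg hs.1 2), abs_of_nonneg (pow_nonneg hs.1 4),
            abs_of_pos (by norm_num : (0:ℝ) < 2)]
      _ ≤ |g₂| * s₁ ^ 2 + 2 * |g₃| * s₁ ^ 4 := by gcongr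
  -- semialgebraicity tools
  have hIooσ : IsSemialgebraic ℚ {t : Fin 1 → ℝ | t 0 ∈ Set.Ioo (0:ℝ) s₁} := by
    have := (isSemialgebraic_setOf_const_lt_apply (n := 1) h0a 0).inter
      (isSemialgebraic_setOf_apply_lt_const (n := 1) as₁ 0)
    convert this using 1; ext t; simp [Set.mem_Ioo]
  have hsR' : IsSemialgebraicFunOn ℚ {t : Fin 1 → ℝ | t 0 ∈ Set.Ioo (0:ℝ) s₁} (fun t => 2 / R (t 0)) := by
    have hR' := hsR.mono (fun t (ht : t 0 ∈ Set.Ioo (0:ℝ) s₁) => Ioo_subset_Icc_self ht) hIooσ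
    have h2 : IsSemialgebraicFunOn ℚ {t : Fin 1 → ℝ | t 0 ∈ Set.Ioo (0:ℝ) s₁} (fun _ => (2:ℝ)) :=
      (isSemialgebraicFunOn_aeval hIooσ (MvPolynomial.C 2)).congr fun t _ => by simp
    exact h2.div hR' fun t ht => (hRpos _ (Ioo_subset_Icc_self ht)).ne'
  have hhatσ : ∀ {S : Set (Fin 2 → ℝ)}, IsSemialgebraic ℚ S →
      IsSemialgebraicFunOn ℚ S (fun z => (g₂ * (z 1) ^ 2 + 2 * g₃ * (z 1) ^ 4) / 4) := by
    intro S hS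
    have hZ1 : IsSemialgebraicFunOn ℚ S (fun z => z 1) :=
      (isSemialgebraicFunOn_aeval hS (MvPolynomial.X 1)).congr fun z _ => by simp
    have hc₂ := isSemialgebraicFunOn_const_of_isAlgebraic hS ag₂
    have hc₃ := isSemialgebraicFunOn_const_of_isAlgebraic hS ag₃
    have hnum : IsSemialgebraicFunOn ℚ S (fun z => g₂ * (z 1) ^ 2 + 2 * g₃ * (z 1) ^ 4) := by
      have h2 : IsSemialgebraicFunOn ℚ S (fun _ => (2:ℝ)) :=
        (isSemialgebraicFunOn_aeval hS (MvPolynomial.C 2)).congr fun t _ => by simp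
      exact IsSemialgebraicFunOn.add_holds (IsSemialgebraicFunOn.mul_holds hc₂
        (IsSemialgebraicFunOn.mul_holds hZ1 hZ1 |>.congr fun z _ => by simp only [Pi.mul_apply]; ring))
        (IsSemialgebraicFunOn.mul_holds (IsSemialgebraicFunOn.mul_holds h2 hc₃)
          ((IsSemialgebraicFunOn.mul_holds (IsSemialgebraicFunOn.mul_holds hZ1 hZ1)
            (IsSemialgebraicFunOn.mul_holds hZ1 hZ1)) |>.congr fun z _ => by simp only [Pi.mul_apply]; ring))
    have h4 : IsSemialgebraicFunOn ℚ S (fun _ => (4:ℝ)) :=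
      (isSemialgebraicFunOn_aeval hS (MvPolynomial.C 4)).congr fun t _ => by simp
    exact hnum.div h4 fun _ _ => by norm_num
  -- B00
  have hB00σ : IsSemialgebraic ℚ {z : Fin 2 → ℝ | (0 < z 0 ∧ z 0 < s₁) ∧ 0 < z 1 ∧ z 1 < s₁} :=
    asmObj_isSemialgebraic_rect h0a as₁ h0a as₁
  have hB00sub : {z : Fin 2 → ℝ | (0 < z 0 ∧ z 0 < s₁) ∧ 0 < z 1 ∧ z 1 < s₁} ⊆
      {z | z 0 ∈ Set.Ioo (0:ℝ) s₁ ∧ z 1 ∈ Set.Ioo (0:ℝ) s₁} := fun z hz => ⟨hz.1, hz.2⟩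
  have hFB : IsSemialgebraicFunOn ℚ {z : Fin 2 → ℝ | (0 < z 0 ∧ z 0 < s₁) ∧ 0 < z 1 ∧ z 1 < s₁}
      (fun z => (g₂ * (z 1) ^ 2 + 2 * g₃ * (z 1) ^ 4) / 4 * (2 / R (z 0)) * (2 / R (z 1))) :=
    IsSemialgebraicFunOn.mul_holds (IsSemialgebraicFunOn.mul_holds (hhatσ hB00σ)
      (asmObj_semialg_apply_zero (φ := fun v => 2 / R v) (A := Set.Ioo 0 s₁) hsR' hB00σ (fun z hz => (hB00sub hz).1)))
      (asmObj_semialg_apply_one (φ := fun v => 2 / R v) (B := Set.Ioo 0 s₁) hsR' hB00σ (fun z hz => (hB00sub hz).2))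
  obtain ⟨B00, hB00d, hB00i⟩ := asmReps_exists_rep2 _ (Set.Ioo 0 s₁) (Set.Ioo 0 s₁) _ (fun _ => 1) (fun _ => 1)
    (Mh * (2 / Rmin) * (2 / Rmin)) hB00σ hB00sub measurableSet_Ioo measurableSet_Ioo hFB
    (integrableOn_const (hs := measure_Ioo_lt_top.ne)) (integrableOn_const (hs := measure_Ioo_lt_top.ne))
    (fun z hz => by
      have hz0 : z 0 ∈ Set.Icc (0:ℝ) s₁ := Ioo_subset_Icc_self (hB00sub hz).1
      have hz1 : z 1 ∈ Set.Icc (0:ℝ) s₁ := Ioo_subset_Icc_self (hB00sub hz).2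
      rw [abs_mul, abs_mul, mul_one, mul_one]
      have hA := hhat _ hz1; have hB := h2R _ hz0; have hC := h2R _ hz1
      have hMh0 : 0 ≤ Mh := (abs_nonneg _).trans hA
      have h2R0 : 0 ≤ 2 / Rmin := (abs_nonneg _).trans hB
      exact mul_le_mul (mul_le_mul hA hB (abs_nonneg _) hMh0) hC (abs_nonneg _) (mul_nonneg hMh0 h2R0))
  -- Cmix
  have hCσ : IsSemialgebraic ℚ {z : Fin 2 → ℝ | (al < z 0 ∧ z 0 < ar) ∧ 0 < z 1 ∧ z 1 < s₁} :=
    asmObj_isSemialgebraic_rect aal aar h0a as₁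
  have hCsub : {z : Fin 2 → ℝ | (al < z 0 ∧ z 0 < ar) ∧ 0 < z 1 ∧ z 1 < s₁} ⊆
      {z | z 0 ∈ Set.Ioo al ar ∧ z 1 ∈ Set.Ioo (0:ℝ) s₁} := fun z hz => ⟨hz.1, hz.2⟩
  have hsqrt := isSemialgebraicFunOn_sqrt_cubic_apply hCσ ag₂ ag₃ hf 0
  have hsqrt_pos : ∀ z ∈ {z : Fin 2 → ℝ | (al < z 0 ∧ z 0 < ar) ∧ 0 < z 1 ∧ z 1 < s₁}, 0 < Real.sqrt (f (z 0)) :=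
    fun z hz => Real.sqrt_pos.2 (hfpos _ (hal.trans_lt hz.1.1))
  have hFC : IsSemialgebraicFunOn ℚ {z : Fin 2 → ℝ | (al < z 0 ∧ z 0 < ar) ∧ 0 < z 1 ∧ z 1 < s₁}
      (fun z => (g₂ * (z 1) ^ 2 + 2 * g₃ * (z 1) ^ 4) / 4 * (Real.sqrt (f (z 0)))⁻¹ * (2 / R (z 1))) :=
    IsSemialgebraicFunOn.mul_holds (IsSemialgebraicFunOn.mul_holds (hhatσ hCσ)
      (hsqrt.inv fun z hz => (hsqrt_pos z hz).ne'))
      (asmObj_semialg_apply_one (φ := fun v => 2 / R v) (B := Set.Ioo 0 s₁) hsR' hCσ (fun z hz => (hCsub hz).2))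
  obtain ⟨Cmix, hCd, hCi⟩ := asmReps_exists_rep2 _ (Set.Ioo al ar) (Set.Ioo 0 s₁) _
    (fun t => (Real.sqrt (f t))⁻¹) (fun _ => 1) (Mh * (2 / Rmin)) hCσ hCsub measurableSet_Ioo measurableSet_Ioo
    hFC hint (integrableOn_const (hs := measure_Ioo_lt_top.ne))
    (fun z hz => by
      have hz1 : z 1 ∈ Set.Icc (0:ℝ) s₁ := Ioo_subset_Icc_self (hCsub hz).2
      have hsq := hsqrt_pos z hz
      rw [abs_mul, abs_mul, mul_one, abs_of_pos (inv_pos.2 hsq)]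
      have hA := hhat _ hz1; have hC := h2R _ hz1
      have hMh0 : 0 ≤ Mh := (abs_nonneg _).trans hA
      calc |(g₂ * z 1 ^ 2 + 2 * g₃ * z 1 ^ 4) / 4| * (Real.sqrt (f (z 0)))⁻¹ * |2 / R (z 1)|
          ≤ Mh * (Real.sqrt (f (z 0)))⁻¹ * (2 / Rmin) :=
            mul_le_mul (mul_le_mul_of_nonneg_right hA (inv_nonneg.2 hsq.le)) hC (abs_nonneg _)
              (mul_nonneg hMh0 (inv_nonneg.2 hsq.le))
        _ = Mh * (2 / Rmin) * (Real.sqrt (f (z 0)))⁻¹ := by ring)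
  exact ⟨B00, Cmix, hB00d, hB00i, hCd, hCi⟩

/-- **Line representations in the chart at infinity**: `[(0,s₁), g·(2/R)]` for `g` continuous on `[0, s₁]` and
`ℚ`-semialgebraic there, resp. for `g` bounded and `ℚ`-semialgebraic on `(0, s₁)`.
[cite: KontsevichZagier2001, §1.1] -/
theorem asmObj_exists_chart_reps1 :
    ∀ (s₁ : ℝ) (R : ℝ → ℝ), IsAlgebraic ℚ s₁ → 0 < s₁ →
    ContinuousOn R (Set.Icc 0 s₁) → (∀ s ∈ Set.Icc 0 s₁, 0 < R s) →
    IsSemialgebraicFunOn ℚ {t : Fin 1 → ℝ | t 0 ∈ Set.Icc 0 s₁} (fun t => R (t 0)) →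
    (∀ g : ℝ → ℝ, ContinuousOn g (Set.Icc 0 s₁) →
      IsSemialgebraicFunOn ℚ {t : Fin 1 → ℝ | t 0 ∈ Set.Icc 0 s₁} (fun t => g (t 0)) →
      ∃ r : Literature.NumberTheory.Transcendental.KZ.IntegralRep 1,
        r.domain = {t | 0 < t 0 ∧ t 0 < s₁} ∧ r.integrand = fun t => g (t 0) * (2 / R (t 0))) ∧
    (∀ (g : ℝ → ℝ) (M : ℝ), (∀ s ∈ Set.Ioo 0 s₁, |g s| ≤ M) →
      IsSemialgebraicFunOn ℚ {t : Fin 1 → ℝ | t 0 ∈ Set.Ioo 0 s₁} (fun t => g (t 0)) →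
      ∃ r : Literature.NumberTheory.Transcendental.KZ.IntegralRep 1,
        r.domain = {t | 0 < t 0 ∧ t 0 < s₁} ∧ r.integrand = fun t => g (t 0) * (2 / R (t 0))) := by
  intro s₁ R as₁ hs₁ hRc hRpos hsR
  have h0a : IsAlgebraic ℚ (0:ℝ) := isAlgebraic_zero
  have hIooσ : IsSemialgebraic ℚ {t : Fin 1 → ℝ | t 0 ∈ Set.Ioo (0:ℝ) s₁} := by
    have := (isSemialgebraic_setOf_const_lt_apply (n := 1) h0a 0).inter
      (isSemialgebraic_setOf_apply_lt_const (n := 1) as₁ 0)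
    convert this using 1; ext t; simp [Set.mem_Ioo]
  have hsR' : IsSemialgebraicFunOn ℚ {t : Fin 1 → ℝ | t 0 ∈ Set.Ioo (0:ℝ) s₁} (fun t => 2 / R (t 0)) := by
    have hR' := hsR.mono (fun t (ht : t 0 ∈ Set.Ioo (0:ℝ) s₁) => Ioo_subset_Icc_self ht) hIooσ
    have h2 : IsSemialgebraicFunOn ℚ {t : Fin 1 → ℝ | t 0 ∈ Set.Ioo (0:ℝ) s₁} (fun _ => (2:ℝ)) :=
      (isSemialgebraicFunOn_aeval hIooσ (MvPolynomial.C 2)).congr fun t _ => by simp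
    exact h2.div hR' fun t ht => (hRpos _ (Ioo_subset_Icc_self ht)).ne'
  have h2Rc : ContinuousOn (fun s => 2 / R s) (Set.Icc 0 s₁) :=
    continuousOn_const.div hRc fun s hs => (hRpos s hs).ne'
  obtain ⟨smin, hsmin, hmin⟩ := isCompact_Icc.exists_isMinOn (nonempty_Icc.2 hs₁.le) hRc
  have hRmin_pos : 0 < R smin := hRpos smin hsmin
  have h2R : ∀ s ∈ Set.Icc (0:ℝ) s₁, |2 / R s| ≤ 2 / R smin := by
    intro s hs
    rw [abs_of_pos (div_pos two_pos (hRpos s hs))]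
    exact div_le_div_of_nonneg_left zero_le_two hRmin_pos (hmin hs)
  refine ⟨fun g hgc hgσ => ?_, fun g M hgM hgσ => ?_⟩
  · obtain ⟨r, hd, hi⟩ := asmReps_exists_rep1_Ioo (fun s => g s * (2 / R s)) hIooσ
      (IsSemialgebraicFunOn.mul_holds (hgσ.mono (fun t (ht : t 0 ∈ Set.Ioo (0:ℝ) s₁) => Ioo_subset_Icc_self ht)
        hIooσ) hsR') (hgc.mul h2Rc)
    exact ⟨r, hd, hi⟩
  · obtain ⟨r, hd, hi⟩ := asmReps_exists_rep1 (Set.Ioo 0 s₁) (fun s => g s * (2 / R s)) (M * (2 / R smin)) hIooσ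
      measurableSet_Ioo measure_Ioo_lt_top.ne (IsSemialgebraicFunOn.mul_holds hgσ hsR') fun s hs => by
        rw [abs_mul]
        exact mul_le_mul (hgM s hs) (h2R s (Ioo_subset_Icc_self hs)) (abs_nonneg _)
          ((abs_nonneg _).trans (hgM s hs))
    exact ⟨r, by rw [hd]; rfl, hi⟩

end Summit.KontsevichZagierPeriods.KontsevichZagierPeriods.Cruxes.NeronTorsionSector.Translation
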